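import Summits.CriticalPhenomena.SAWScalingLimit.Theses.SAWTwistedSelfEnergy

/-!
# Birth skeleton (`Lines/birth.lean`) for crux `TwistedKernelTailIndex` (stmt-CriticalPhenomena-17873)

Route `SAWTwistedSelfEnergy` of `CriticalPhenomena/SAWScalingLimit`, crux r3 `TwistedKernelTailIndex`:
for the recursion-defined spin-`5/8` twisted self-energy `K_n(z) ∈ ℂ^{4×4}` of the `ℤ²` self-avoiding walk
(`G_n = T·G_{n-1} + Σ_m K_m ⋆ G_{n-m}`), the `n`-resolved absolute moments
`Σ_{(n,z)} x_c^n |z|^s ‖K_n(z)‖₁` are FINITE for `0 ≤ s < 3/4` and INFINITE for `s > 3/4`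
(moment abscissa exactly `3/4 = 2 − 2σ`, tail index `11/4 = 4 − 2σ`).

## The line: X-SPACE TAIL LAW ⇒ MOMENT ABSCISSA (Tauberian bookkeeping made explicit; 2 registered stubs)

Write `a_n(z) = Σ_{ι,κ} |K_n(z)_{ικ}|` and `k_N(z) = Σ_{n<N} x_c^n a_n(z)` (length-truncated absolute kernel).
The two-sided abscissa statement is cut into its two HALVES, each stated in the form a kernel analysis
actually delivers (pointwise / dyadic-shell `x`-space bounds with `ε`-room for slowly varying corrections),
and the passage to moments over `ℕ × ℤ²` is PROVED here:

* `stub_kernelTailUpper : KernelTailUpper` (L, open — the UPPER half, "tail exponent ≥ 11/4"): for every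
  `ε > 0` there is `C` with `k_N(z) ≤ C (1+|z|)^{-(11/4-ε)}` for ALL `z` and ALL cut-offs `N`.  This is the
  lace-expansion-native statement (diagrammatic bounds are pointwise `x`-space decay estimates, cf. Hara's
  `|Π(x)| ≤ C|x|^{-(d+2+…)}`, arXiv:math-ph/0504021; NoBLE arXiv:1506.07969); it contains the sibling crux
  `TwistedKernelSummable` (stmt-17872, the case "`z` fixed") and encodes the anomalous dimension
  `2σ = 5/4` as the decay `4 − 2σ` of the self-energy.
* `stub_kernelShellLower : KernelShellLower` (L, open — the LOWER half, "tail exponent ≤ 11/4"): for every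
  `ε > 0` there are `c > 0` and `J` such that every dyadic shell `2^j < ‖z‖_∞ ≤ 2^{j+1}`, `j ≥ J`, carries
  absolute kernel mass `Σ_{n<N} Σ_{z ∈ shell} x_c^n a_n(z) ≥ c·2^{-(3/4+ε)j}` for some cut-off `N`: the
  degree-`3/4` non-analyticity of `K̂` at `k = 0` has a NON-ZERO coefficient (no pointwise lower bound is
  claimed — shells, not sites).
* PROVED glue (no `sorry`): the planar lattice zeta bound `Σ_z (1+|z|)^{-α} < ∞` for `α > 2`
  (`summable_one_add_norm_rpow_neg`, from Mathlib's `EisensteinSeries.summable_one_div_norm_rpow`), clause 1 from the upper stub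
  by bounding every finite partial sum over `ℕ × ℤ²` (`summable_of_sum_le`), clause 2 from the lower stub by
  exhibiting finite partial sums `≥ c·2^{εj} → ∞` (`Summable.sum_le_tsum`), and `TwistedKernelTailIndex_of`
  concluding the route decl BY NAME through `tailIndex_iff : TwistedKernelTailIndex' ↔ … := Iff.rfl`
  (the primed form is the crux with its five `let`s zeta-reduced into the §1 vocabulary).

Why `ε`-room and shells: the crux is the "log-free form" of card K1 — a multiplicative slowly varying
correction `(log|z|)^β` to the `|z|^{-11/4}` tail changes neither clause, so the stubs must not claim a pure
power either; and a POINTWISE lower bound in every lattice direction would be a far stronger (and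
unmotivated) claim than the non-vanishing of one tail constant, whence the dyadic-shell form of the lower half.

## Disproof / negatives used
* `Cruxes/TwistedKernelTailIndex/Disproof.lean`: none exists (`ledger crux ls stmt-CriticalPhenomena-17873`:
  "no workfiles yet", 2026-08-17) — no `_false_without_` obstruction to honour, no landed
  `Theorems/TwistedKernelTailIndex/Negative/*`.
* `ledger negatives --problem CriticalPhenomena` (11 entries, 2026-08-17): none concerns a lace / self-energy
  kernel, a moment or a tail statement (the only SAW-series entry, stmt-8261, is an infinite-divisibility
  claim for `x ≤ x_c`, unrelated); nothing to avoid.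
* Vacuity / junk pass: `IsTwistedKernel` has exactly one solution (the `m = n` term isolates `K_n(z)`;
  refuter note on the item), so `∀ K, IsTwistedKernel K → …` is neither vacuous nor over-general; `0^s`
  at `z = 0` is harmless (`(1+|z|)` weights in the stubs; in the crux `s ≥ 0` and the `z = 0` term is one
  summand); the stubs quantify `∃ C` / `∃ c > 0, ∃ J` AFTER `ε`, and the cut-off `N` is universally
  quantified in the upper stub (uniform bound = bound on the series) and existentially in the lower one
  (a finite witness of shell mass), so neither is trivialised by truncation.
-/

noncomputable section

open scoped BigOperators Topology Manifold Classical MeasureTheory ProbabilityTheory Matrix InnerProductSpace ComplexConjugate ContinuousMap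
open Filter Set Function TopologicalSpace MeasureTheory
open Literature.Probability.LatticeModels

namespace Summit.CriticalPhenomena.SAWScalingLimit.Cruxes.TwistedKernelTailIndex.Birth

/-! ### 1. Vocabulary (verbatim from the crux) -/

/-- The four lattice directions `E, N, W, S` (VERBATIM the crux's `let dir`). -/
def dir : Fin 4 → Site 2 := ![![1, 0], ![0, 1], ![-1, 0], ![0, -1]]

/-- The parafermionic spin `σ = 5/8` (VERBATIM the crux's `let σ`). -/
def spin : ℝ := 5 / 8

/-- The twisted non-backtracking one-step matrix `T` (VERBATIM the crux's `let T`). -/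
def transfer : Matrix (Fin 4) (Fin 4) ℂ := fun a b =>
  if dir b = -dir a then 0
  else Complex.exp (-Complex.I * spin *
    (Literature.Probability.LatticeModels.turning
      (-Site.toComplex (dir a)) 0 (Site.toComplex (dir b)) : ℝ))

/-- The spin-`5/8` twisted two-point matrices `G_n(z)(ι, κ)` of the `ℤ²` SAW (VERBATIM the crux's `let G`). -/
def twoPoint : ℕ → Site 2 → Matrix (Fin 4) (Fin 4) ℂ := fun n z ι κ =>
  if n = 0 then (if z = 0 ∧ ι = κ then 1 else 0)
  else ∑ p ∈ ((zdGraph 2).finsetWalkLength n (0 : Site 2) z).filter (fun p => p.IsPath),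
    (if p.getVert 1 = -dir ι ∨ z - p.getVert (n - 1) ≠ dir κ then 0
     else Complex.exp (-Complex.I * spin *
       (Literature.Probability.LatticeModels.winding
         ((-Site.toComplex (dir ι)) :: (p.support.map Site.toComplex)) : ℝ)))

/-- The resolvent recursion defining the twisted self-energy `K` (VERBATIM the crux's `let IsTwistedKernel`). -/
def IsTwistedKernel (K : ℕ → Site 2 → Matrix (Fin 4) (Fin 4) ℂ) : Prop :=
  (∀ n z, z ∉ box 2 n → K n z = 0) ∧
  (∀ n, 1 ≤ n → ∀ z, twoPoint n z =
    Matrix.of (fun ι κ => ∑ κ' : Fin 4, twoPoint (n - 1) (z - dir κ) ι κ' * transfer κ' κ) +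
      ∑ m ∈ Finset.Icc 1 n, ∑ y ∈ box 2 m, K m y * twoPoint (n - m) (z - y))

/-- The critical fugacity `x_c = 1/μ(ℤ²)`. -/
abbrev xc : ℝ := Literature.Probability.RandomPlanarGeometry.SAW.criticalFugacity

/-- The entrywise `ℓ¹` norm `a_n(z) = Σ_{ι,κ} |K_n(z)_{ικ}|` of the kernel (VERBATIM the crux's inner double sum). -/
def absK (K : ℕ → Site 2 → Matrix (Fin 4) (Fin 4) ℂ) (n : ℕ) (z : Site 2) : ℝ :=
  ∑ ι : Fin 4, ∑ κ : Fin 4, ‖K n z ι κ‖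

/-- The crux's moment summand `x_c^n |z|^s a_n(z)` on `ℕ × ℤ²`. -/
def moment (K : ℕ → Site 2 → Matrix (Fin 4) (Fin 4) ℂ) (s : ℝ) : ℕ × Site 2 → ℝ := fun p =>
  xc ^ p.1 * ‖Site.toComplex p.2‖ ^ s * absK K p.1 p.2

/-- The crux with its `let`s zeta-reduced into the §1 vocabulary (definitionally the route decl, see
`tailIndex_iff`). -/
def TwistedKernelTailIndex' : Prop :=
  ∀ K : ℕ → Site 2 → Matrix (Fin 4) (Fin 4) ℂ, IsTwistedKernel K →
    (∀ s : ℝ, 0 ≤ s → s < 3 / 4 → Summable (moment K s)) ∧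
    (∀ s : ℝ, 3 / 4 < s → ¬ Summable (moment K s))

/-- The primed form IS the route decl: `TwistedKernelTailIndex` unfolds (delta, then zeta on `dir`, `σ`, `T`,
`G`, `IsTwistedKernel`, then delta on the §1 vocabulary) to `TwistedKernelTailIndex'`. -/
theorem tailIndex_iff :
    TwistedKernelTailIndex' ↔
      Summit.CriticalPhenomena.SAWScalingLimit.Theses.SAWTwistedSelfEnergy.TwistedKernelTailIndex :=
  Iff.rfl

/-! ### 2. The stub statements -/

/-- STUB 1 statement — **pointwise `x`-space tail bound, upper half** (`ε`-robust, uniform over length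
cut-offs): `Σ_{n<N} x_c^n a_n(z) ≤ C_ε (1+|z|)^{-(11/4-ε)}` for all `z ∈ ℤ²`, `N ∈ ℕ`. -/
def KernelTailUpper : Prop :=
  ∀ K : ℕ → Site 2 → Matrix (Fin 4) (Fin 4) ℂ, IsTwistedKernel K →
    ∀ ε : ℝ, 0 < ε → ∃ C : ℝ, ∀ (z : Site 2) (N : ℕ),
      ∑ n ∈ Finset.range N, xc ^ n * absK K n z ≤ C * (1 + ‖Site.toComplex z‖) ^ (-(11 / 4 - ε))

/-- STUB 2 statement — **dyadic-shell mass, lower half** (`ε`-robust): the shells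
`annulus 2 (2^j) (2^(j+1)) = {2^j < ‖z‖_∞ ≤ 2^(j+1)}`, `j ≥ J_ε`, carry truncated absolute kernel mass
`≥ c_ε 2^{-(3/4+ε) j}`. -/
def KernelShellLower : Prop :=
  ∀ K : ℕ → Site 2 → Matrix (Fin 4) (Fin 4) ℂ, IsTwistedKernel K →
    ∀ ε : ℝ, 0 < ε → ∃ c : ℝ, 0 < c ∧ ∃ J : ℕ, ∀ j : ℕ, J ≤ j → ∃ N : ℕ,
      c * (2 : ℝ) ^ (-((3 / 4 + ε) * j)) ≤
        ∑ n ∈ Finset.range N, ∑ z ∈ annulus 2 (2 ^ j) (2 ^ (j + 1)), xc ^ n * absK K n z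

/-! ### 3. The registered stubs (the only `sorry`s of the file) -/

/-- STUB 1 (L, open): the upper `x`-space tail bound of the twisted self-energy at `x_c`. -/
theorem stub_kernelTailUpper : KernelTailUpper := by
  sorry

/-- STUB 2 (L, open): the dyadic-shell lower bound — the degree-`3/4` singularity of `K̂` at `k = 0` has a
non-zero coefficient. -/
theorem stub_kernelShellLower : KernelShellLower := by
  sorry

/-! ### Name-keyed aliases of the stub statements (hypotheses of the composition)

`Registered.stub_X : Prop` is the statement of `stub_X` under the registered stub's short name, so that the
skeleton audit (hypotheses admissible iff registered stubs BY NAME) accepts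
`TwistedKernelTailIndex_of : Registered.stub_… → … → TwistedKernelTailIndex` (device of
`Cruxes/ChainLaw/Lines/birth.lean`, `Cruxes/BalanceChannel/Lines/birth.lean`). -/
namespace Registered

/-- Alias keyed by the registered stub name. -/
abbrev stub_kernelTailUpper : Prop := KernelTailUpper
/-- Alias keyed by the registered stub name. -/
abbrev stub_kernelShellLower : Prop := KernelShellLower

end Registered

/-! ### 4. The sorry-free part: lattice bookkeeping and the compositions -/

/-- `x_c > 0` (`μ(ℤ²) ≥ 1`, in tree). -/
theorem xc_pos : 0 < xc := by
  have h := Literature.Probability.RandomPlanarGeometry.SAW.Zd.connectiveConstant_pos 2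
  rw [Literature.Probability.RandomPlanarGeometry.SAW.Zd.connectiveConstant_two] at h
  exact inv_pos.2 h

theorem absK_nonneg (K : ℕ → Site 2 → Matrix (Fin 4) (Fin 4) ℂ) (n : ℕ) (z : Site 2) : 0 ≤ absK K n z :=
  Finset.sum_nonneg fun _ _ => Finset.sum_nonneg fun _ _ => norm_nonneg _

theorem moment_nonneg (K : ℕ → Site 2 → Matrix (Fin 4) (Fin 4) ℂ) (s : ℝ) (p : ℕ × Site 2) :
    0 ≤ moment K s p :=
  mul_nonneg (mul_nonneg (pow_nonneg xc_pos.le _) (Real.rpow_nonneg (norm_nonneg _) _)) (absK_nonneg K _ _)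

theorem moment_apply (K : ℕ → Site 2 → Matrix (Fin 4) (Fin 4) ℂ) (s : ℝ) (n : ℕ) (z : Site 2) :
    moment K s (n, z) = xc ^ n * ‖Site.toComplex z‖ ^ s * absK K n z := rfl

/-- Each coordinate is dominated by the Euclidean norm of the complex embedding. -/
theorem abs_apply_le_norm_toComplex (z : Site 2) (i : Fin 2) :
    |((z i : ℤ) : ℝ)| ≤ ‖Site.toComplex z‖ := by
  fin_cases i
  · simpa using Complex.abs_re_le_norm (Site.toComplex z)
  · simpa using Complex.abs_im_le_norm (Site.toComplex z)

/-- The sup norm of `ℤ²` is dominated by the Euclidean norm of the complex embedding. -/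
theorem norm_le_norm_toComplex (z : Site 2) : ‖z‖ ≤ ‖Site.toComplex z‖ :=
  (pi_norm_le_iff_of_nonneg (norm_nonneg _)).2 fun i => by
    rw [Int.norm_eq_abs]
    exact abs_apply_le_norm_toComplex z i

/-- **Planar lattice zeta bound**: `Σ_{z ∈ ℤ²} (1 + |z|)^{-α} < ∞` for `α > 2` (from Mathlib's
`EisensteinSeries.summable_one_div_norm_rpow`, sup norm on `Fin 2 → ℤ`, plus the origin). -/
theorem summable_one_add_norm_rpow_neg {α : ℝ} (hα : 2 < α) :
    Summable fun z : Site 2 => (1 + ‖Site.toComplex z‖) ^ (-α) := by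
  have h0 : Summable fun z : Site 2 => ‖z‖ ^ (-α) := EisensteinSeries.summable_one_div_norm_rpow hα
  have h1 : Summable fun z : Site 2 => (if z = 0 then (1 : ℝ) else 0) := by
    refine summable_of_ne_finset_zero (s := {0}) ?_
    intro z hz
    rw [Finset.mem_singleton] at hz
    simp [hz]
  refine Summable.of_nonneg_of_le (fun z => Real.rpow_nonneg (by positivity) _) (fun z => ?_) (h0.add h1)
  by_cases hz : z = 0
  · subst hz
    have h00 : Site.toComplex (0 : Site 2) = 0 := Complex.ext (by simp) (by simp)
    simp only [h00, norm_zero, add_zero, Real.one_rpow, if_true]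
    linarith [Real.rpow_nonneg (le_refl (0 : ℝ)) (-α)]
  · have hzpos : 0 < ‖z‖ := norm_pos_iff.2 hz
    have hle : ‖z‖ ≤ 1 + ‖Site.toComplex z‖ := by linarith [norm_le_norm_toComplex z, norm_nonneg z]
    simp only [hz, if_false, add_zero]
    exact Real.rpow_le_rpow_of_nonpos hzpos hle (by linarith)

/-- **Upper half ⇒ clause 1 (no `sorry`)**: the pointwise tail bound with `ε = (3/4 − s)/2` bounds every finite
partial sum of the `s`-moment over `ℕ × ℤ²` by `C · Σ_z (1+|z|)^{-(2 + ε)}`. -/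
theorem summable_moment_of_tailUpper {K : ℕ → Site 2 → Matrix (Fin 4) (Fin 4) ℂ}
    (hU : ∀ ε : ℝ, 0 < ε → ∃ C : ℝ, ∀ (z : Site 2) (N : ℕ),
      ∑ n ∈ Finset.range N, xc ^ n * absK K n z ≤ C * (1 + ‖Site.toComplex z‖) ^ (-(11 / 4 - ε)))
    {s : ℝ} (hs0 : 0 ≤ s) (hs : s < 3 / 4) : Summable (moment K s) := by
  obtain ⟨C, hC⟩ := hU ((3 / 4 - s) / 2) (by linarith)
  -- a non-negative constant
  set C' : ℝ := max C 0 with hC'def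
  have hC'0 : 0 ≤ C' := le_max_right _ _
  have hC' : ∀ (z : Site 2) (N : ℕ), ∑ n ∈ Finset.range N, xc ^ n * absK K n z ≤
      C' * (1 + ‖Site.toComplex z‖) ^ (-(11 / 4 - (3 / 4 - s) / 2)) := fun z N =>
    (hC z N).trans (mul_le_mul_of_nonneg_right (le_max_left _ _) (Real.rpow_nonneg (by positivity) _))
  -- the summable majorant in `z`
  have hα : (2 : ℝ) < 11 / 4 - (3 / 4 - s) / 2 - s := by linarith
  have hzeta := summable_one_add_norm_rpow_neg hα
  refine summable_of_sum_le (fun p => moment_nonneg K s p) (c := C' * ∑' z : Site 2,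
    (1 + ‖Site.toComplex z‖) ^ (-(11 / 4 - (3 / 4 - s) / 2 - s))) fun u => ?_
  -- a finite set of indices sits in a product `range N ×ˢ Z`
  set Z : Finset (Site 2) := u.image Prod.snd with hZ
  set N : ℕ := u.sup Prod.fst + 1 with hN
  have hsub : u ⊆ Finset.range N ×ˢ Z := by
    intro p hp
    rw [Finset.mem_product, Finset.mem_range]
    exact ⟨Nat.lt_succ_of_le (Finset.le_sup (f := Prod.fst) hp), Finset.mem_image_of_mem _ hp⟩
  calc ∑ p ∈ u, moment K s p
      ≤ ∑ p ∈ Finset.range N ×ˢ Z, moment K s p :=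
        Finset.sum_le_sum_of_subset_of_nonneg hsub fun p _ _ => moment_nonneg K s p
    _ = ∑ z ∈ Z, ∑ n ∈ Finset.range N, moment K s (n, z) := Finset.sum_product_right _ _ _
    _ = ∑ z ∈ Z, ‖Site.toComplex z‖ ^ s * ∑ n ∈ Finset.range N, xc ^ n * absK K n z := by
        refine Finset.sum_congr rfl fun z _ => ?_
        rw [Finset.mul_sum]
        refine Finset.sum_congr rfl fun n _ => ?_
        rw [moment_apply]
        ring
    _ ≤ ∑ z ∈ Z, ‖Site.toComplex z‖ ^ s *
          (C' * (1 + ‖Site.toComplex z‖) ^ (-(11 / 4 - (3 / 4 - s) / 2))) :=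
        Finset.sum_le_sum fun z _ =>
          mul_le_mul_of_nonneg_left (hC' z N) (Real.rpow_nonneg (norm_nonneg _) _)
    _ ≤ ∑ z ∈ Z, C' * (1 + ‖Site.toComplex z‖) ^ (-(11 / 4 - (3 / 4 - s) / 2 - s)) := by
        refine Finset.sum_le_sum fun z _ => ?_
        have hw : 0 ≤ ‖Site.toComplex z‖ := norm_nonneg _
        have hpos : 0 < 1 + ‖Site.toComplex z‖ := by positivity
        have h1 : ‖Site.toComplex z‖ ^ s ≤ (1 + ‖Site.toComplex z‖) ^ s :=
          Real.rpow_le_rpow hw (by linarith) hs0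
        calc ‖Site.toComplex z‖ ^ s * (C' * (1 + ‖Site.toComplex z‖) ^ (-(11 / 4 - (3 / 4 - s) / 2)))
            ≤ (1 + ‖Site.toComplex z‖) ^ s *
                (C' * (1 + ‖Site.toComplex z‖) ^ (-(11 / 4 - (3 / 4 - s) / 2))) :=
              mul_le_mul_of_nonneg_right h1 (mul_nonneg hC'0 (Real.rpow_nonneg hpos.le _))
          _ = C' * ((1 + ‖Site.toComplex z‖) ^ s *
                (1 + ‖Site.toComplex z‖) ^ (-(11 / 4 - (3 / 4 - s) / 2))) := by ring
          _ = C' * (1 + ‖Site.toComplex z‖) ^ (-(11 / 4 - (3 / 4 - s) / 2 - s)) := by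
              rw [← Real.rpow_add hpos]
              congr 2
              ring
    _ = C' * ∑ z ∈ Z, (1 + ‖Site.toComplex z‖) ^ (-(11 / 4 - (3 / 4 - s) / 2 - s)) :=
        (Finset.mul_sum _ _ _).symm
    _ ≤ C' * ∑' z : Site 2, (1 + ‖Site.toComplex z‖) ^ (-(11 / 4 - (3 / 4 - s) / 2 - s)) :=
        mul_le_mul_of_nonneg_left
          (hzeta.sum_le_tsum Z fun z _ => Real.rpow_nonneg (by positivity) _) hC'0

/-- On the dyadic shell `annulus 2 (2^j) (2^(j+1))` the Euclidean norm is at least `2^j`. -/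
theorem two_pow_le_norm_of_mem_annulus {j : ℕ} {z : Site 2}
    (hz : z ∈ annulus 2 (2 ^ j) (2 ^ (j + 1))) : (2 : ℝ) ^ j ≤ ‖Site.toComplex z‖ := by
  have hz2 : z ∉ box 2 (2 ^ j) := (Finset.mem_sdiff.1 hz).2
  simp only [mem_box, not_forall, not_and, not_le] at hz2
  obtain ⟨i, hi⟩ := hz2
  have habs : ((2 ^ j : ℕ) : ℤ) ≤ |z i| := by
    have hL0 : (0 : ℤ) ≤ ((2 ^ j : ℕ) : ℤ) := Int.natCast_nonneg _
    generalize ((2 ^ j : ℕ) : ℤ) = L at hi hL0 ⊢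
    rcases lt_or_ge (z i) (-L) with h | h
    · rw [abs_of_neg (by omega)]
      omega
    · have := hi h
      rw [abs_of_pos (by omega)]
      omega
  have hR : ((2 : ℝ) ^ j) ≤ |((z i : ℤ) : ℝ)| := by
    have h := (Int.cast_le (R := ℝ)).2 habs
    push_cast at h
    exact h
  exact hR.trans (abs_apply_le_norm_toComplex z i)

/-- **Lower half ⇒ clause 2 (no `sorry`)**: with `ε = (s − 3/4)/2`, the shells `j ≥ J` give finite partial
sums of the `s`-moment `≥ c · 2^{ε j} → ∞`, while summability bounds every finite partial sum. -/
theorem not_summable_moment_of_shellLower {K : ℕ → Site 2 → Matrix (Fin 4) (Fin 4) ℂ}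
    (hL : ∀ ε : ℝ, 0 < ε → ∃ c : ℝ, 0 < c ∧ ∃ J : ℕ, ∀ j : ℕ, J ≤ j → ∃ N : ℕ,
      c * (2 : ℝ) ^ (-((3 / 4 + ε) * j)) ≤
        ∑ n ∈ Finset.range N, ∑ z ∈ annulus 2 (2 ^ j) (2 ^ (j + 1)), xc ^ n * absK K n z)
    {s : ℝ} (hs : 3 / 4 < s) : ¬ Summable (moment K s) := by
  intro hsum
  obtain ⟨c, hc, J, hJ⟩ := hL ((s - 3 / 4) / 2) (by linarith)
  have hs0 : 0 ≤ s := by linarith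
  -- every qualifying shell bounds `c · 2^{ε j}` by the total sum
  have key : ∀ j : ℕ, J ≤ j → c * (2 : ℝ) ^ ((s - 3 / 4) / 2 * j) ≤ ∑' p, moment K s p := by
    intro j hj
    obtain ⟨N, hN⟩ := hJ j hj
    have h2j : (0 : ℝ) ≤ (2 : ℝ) ^ (s * j) := Real.rpow_nonneg (by norm_num) _
    calc c * (2 : ℝ) ^ ((s - 3 / 4) / 2 * j)
        = (2 : ℝ) ^ (s * j) * (c * (2 : ℝ) ^ (-((3 / 4 + (s - 3 / 4) / 2) * j))) := by
          rw [mul_left_comm, ← Real.rpow_add (by norm_num : (0 : ℝ) < 2)]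
          congr 2
          ring
      _ ≤ (2 : ℝ) ^ (s * j) *
            ∑ n ∈ Finset.range N, ∑ z ∈ annulus 2 (2 ^ j) (2 ^ (j + 1)), xc ^ n * absK K n z :=
          mul_le_mul_of_nonneg_left hN h2j
      _ = ∑ n ∈ Finset.range N, ∑ z ∈ annulus 2 (2 ^ j) (2 ^ (j + 1)),
            (2 : ℝ) ^ (s * j) * (xc ^ n * absK K n z) := by
          rw [Finset.mul_sum]
          refine Finset.sum_congr rfl fun n _ => ?_
          rw [Finset.mul_sum]
      _ ≤ ∑ n ∈ Finset.range N, ∑ z ∈ annulus 2 (2 ^ j) (2 ^ (j + 1)), moment K s (n, z) := by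
          refine Finset.sum_le_sum fun n _ => Finset.sum_le_sum fun z hz => ?_
          rw [moment_apply, mul_comm (xc ^ n) (‖Site.toComplex z‖ ^ s), mul_assoc]
          refine mul_le_mul_of_nonneg_right ?_ (mul_nonneg (pow_nonneg xc_pos.le _) (absK_nonneg K _ _))
          calc (2 : ℝ) ^ (s * j) = ((2 : ℝ) ^ j) ^ s := by
                rw [mul_comm, Real.rpow_mul (by norm_num : (0 : ℝ) ≤ 2), Real.rpow_natCast]
            _ ≤ ‖Site.toComplex z‖ ^ s :=
                Real.rpow_le_rpow (by positivity) (two_pow_le_norm_of_mem_annulus hz) hs0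
      _ = ∑ p ∈ Finset.range N ×ˢ annulus 2 (2 ^ j) (2 ^ (j + 1)), moment K s p :=
          (Finset.sum_product _ _ _).symm
      _ ≤ ∑' p, moment K s p := hsum.sum_le_tsum _ fun p _ => moment_nonneg K s p
  -- but `c · 2^{ε j} → ∞`
  have hgrow : Tendsto (fun j : ℕ => c * (2 : ℝ) ^ ((s - 3 / 4) / 2 * j)) atTop atTop := by
    have h1 : (1 : ℝ) < (2 : ℝ) ^ ((s - 3 / 4) / 2) := Real.one_lt_rpow one_lt_two (by linarith)
    have h2 : Tendsto (fun j : ℕ => ((2 : ℝ) ^ ((s - 3 / 4) / 2)) ^ j) atTop atTop :=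
      tendsto_pow_atTop_atTop_of_one_lt h1
    refine Tendsto.const_mul_atTop hc (h2.congr fun j => ?_)
    rw [← Real.rpow_natCast, ← Real.rpow_mul (by norm_num : (0 : ℝ) ≤ 2)]
  obtain ⟨j, hj1, hj2⟩ := ((hgrow.eventually_gt_atTop (∑' p, moment K s p)).and
    (eventually_ge_atTop J)).exists
  exact absurd (key j hj2) (not_le.2 hj1)

/-- **The two halves ⇒ the crux, zeta-reduced form (no `sorry`).** -/
theorem tailIndex'_of (hU : KernelTailUpper) (hL : KernelShellLower) : TwistedKernelTailIndex' :=
  fun K hK =>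
    ⟨fun _ hs0 hs => summable_moment_of_tailUpper (hU K hK) hs0 hs,
     fun _ hs => not_summable_moment_of_shellLower (hL K hK) hs⟩

/-- **The composition (kernel-checked, no `sorry`)**: the two registered stubs imply the crux
`TwistedKernelTailIndex` BY NAME. -/
theorem TwistedKernelTailIndex_of (h1 : Registered.stub_kernelTailUpper)
    (h2 : Registered.stub_kernelShellLower) :
    Summit.CriticalPhenomena.SAWScalingLimit.Theses.SAWTwistedSelfEnergy.TwistedKernelTailIndex :=
  tailIndex_iff.mp (tailIndex'_of h1 h2)

/-- Wiring check: the registered stubs feed `TwistedKernelTailIndex_of` as stated. -/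
example : Summit.CriticalPhenomena.SAWScalingLimit.Theses.SAWTwistedSelfEnergy.TwistedKernelTailIndex :=
  TwistedKernelTailIndex_of stub_kernelTailUpper stub_kernelShellLower

end Summit.CriticalPhenomena.SAWScalingLimit.Cruxes.TwistedKernelTailIndex.Birth

end
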